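import Mathlib
import HarnessLib
import HarnessLib.Audit
import Summits.Langlands.Langlands.Theorems.ReductionSignatureSplitPrelude

/-!
# `ReductionSignatureSplit` — lens-5 g33 node on CORE = `OddPrimeDoorSplit.CoreResidual`

Cell `decomp-langlands`, lens 5 («finite/base range + asymptotic regime + bridge») in RESIDUAL MODE on the
lineage REST (stmt-Langlands-26998, `Theses.TowerDoorSplit.UnanchoredHighDegreeWitnessAutomorphy`) → REST_E → LJR →
RES → CORE, where CORE = `Summit.Langlands.Langlands.Theorems.OddPrimeDoorSplit.CoreResidual` (g30, tree): every
integral `E` (`Δ ≠ 0`) over an UNANCHORED totally real `K₀` (`[K₀:ℚ] ≥ 6`), `[ℚ(j):ℚ]` in the residual range, off the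
Allen locus and OFF g30's three odd-prime doors (`OffDoors`: not FLS-generic at `3, 5, 7`; on no Skinner–Wiles locus;
on no Pan–Zhang locus) is modular.  g31 (`RealCyclotomicDoorSplit`) refined CORE by the FIELD dial `K₀ ∩ ℚ(ζ₅)⁺`,
`K₀ ∩ ℚ(ζ₇)⁺` (CORE ⟸ BOX13 ∧ CORE′; CORE′ ⟺ CELL D ∧ CELL T; CELL D ⟺ four level-`105` cells).  g30's own
docstring of CORE names what is left at the dihedral primes: "dihedral and potentially good ordinary / mixed above `p`".
That is the regime this node cuts.

## The dial (a property of `j(E)` and `K₀` only — model-free, twist-invariant): the REDUCTION SIGNATURE above `p`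

For `p ∈ {3, 5, 7}` and a place `v ∣ p` of `K₀` put `j_ss(3) = j_ss(5) = 0`, `j_ss(7) = 1728` (the unique supersingular
`j`-invariant in characteristic `p ≤ 7`).  Then (Tate's algorithm / Deuring):
* `v(j − j_ss(p)) > 0` (Mathlib: `v.valuation K₀ (j − j_ss) < 1`) ⟺ `E` is POTENTIALLY SUPERSINGULAR at `v`
  (`SupersingularPlace`; g30's `PotSupersingularAbove` = "every `v ∣ p` is a supersingular place", `Iff.rfl`);
* `v(j − j_ss(p)) ≤ 0` ⟺ `E` is potentially ORDINARY (good, `v(j) ≥ 0`, `j ≢ j_ss`) or potentially MULTIPLICATIVE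
  (`v(j) < 0`) at `v` — in both cases `ρ_{E,p}|_{D_v}` is NEARLY ORDINARY (upper triangular: the canonical
  étale quotient descends to `K₀ᵥ`), Skinner–Wiles' hypothesis (5.1)(iv).
The SIGNATURE of `E` above `p` is the partition of `{v ∣ p}` into supersingular and nearly-ordinary places:
PURE SUPERSINGULAR (`PotSupersingularAbove`), PURE NEARLY-ORDINARY (`NoSupersingularAbove`), or MIXED
(`SomeSupersingularAbove ∧ SomeOrdinaryAbove`) — `signature_trichotomy`.  g30's door 2 consumed only the pure
potentially-MULTIPLICATIVE signature (`PotMultAbove ⊂ NoSupersingularAbove`, `noSupersingularAbove_of_potMultAbove`),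
door 3 only the pure supersingular signature on `p`-totally-split fields.

## The doors (junctions typed at E-level over g30's tree vocabulary)

* DOOR 4a — NOD₃ `NearlyOrdinaryDihedralDoorThree` (PRINT junction; CONTAINS g30's door 2 at `p = 3`,
  `noLocus_of_swLocus`): `ρ̄_{E,3}` absolutely irreducible and NOT generic at `3` (image `C_s⁺(3)`, dihedral, induced
  from the CM field `K₀(√-3)`), PURE NEARLY-ORDINARY signature above `3`, and `μ₃ ⊄ K₀ᵥ` for all `v ∣ 3` ⇒ modular.
  Print chain = g30's door-2 chain with (5.1)(iv) now supplied by potentially good ORDINARY or multiplicative reduction: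
  Skinner–Wiles 2001, Thm. 5.1 [SkinnerWiles2001 = doi:10.5802/afst.988, p. 203–204: "(i) ρ̄^ss irreducible and
  D_i-distinguished … (ii) a nearly-ordinary π₀ with ρ_{π₀} a χ₂-good lift"] + Wiles 1988 / Hida (the weight-one
  theta series of the Teichmüller lift of `χ̄` is `U_v`-ordinary because every `v ∣ 3` RAMIFIES in `K₀(ζ₃)` when
  `μ₃ ⊄ K₀ᵥ`, and moves to weight `2` in its Hida family).  WHY `p = 3` ONLY: for a nearly-ordinary place `v ∣ 3` the
  reduced ordinary curve has `j̃ ≠ 0 = 1728`, so `Aut = ±1`, the semistabilising twist `τ` is quadratic, the étale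
  character `χ̄₂ = τ̄λ̄` satisfies `χ̄₂² = 1`, and with `χ̄₁χ̄₂ = ω`:  `D_v`-distinguished ⟺ `ω|_{D_v} ≠ 1` ⟺ `μ₃ ⊄ K₀ᵥ`
  = g30's `NoLocalMuAbove K₀ 3` EXACTLY.  At `p = 5, 7` ordinary `j̃ ∈ {1728}, {0}` have `Aut = μ₄, μ₆` and
  distinguishedness is a condition on `E[p]|_{D_v}` finer than `NoLocalMuAbove` — except on a TOTALLY SPLIT `p`:
* DOOR 4b — NOS `SplitOrdinaryDihedralDoor` (PRINT junction; CONTAINS g30's door 2 at every totally split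
  `p ∈ {3,5,7}`, `splitNOLocus_of_swLocus`): `p ∈ {3,5,7}` TOTALLY SPLIT in `K₀`, `ρ̄_{E,p}` absolutely irreducible and
  not generic at `p`, PURE NEARLY-ORDINARY signature above `p` ⇒ modular.  Same print chain; `D_v`-distinguishedness is
  AUTOMATIC on `K₀ᵥ = ℚ_p`: by Serre–Tate the semistabilising inertia `Φ` embeds in `Aut(Ẽ)`, cyclic of order dividing
  `2, 4, 6` for an ordinary reduction in characteristic `3, 5, 7`, so `χ̄₂²|_{I_v}` has order dividing `1, 2, 3`, while
  `ω|_{I_v}` has order `p − 1 = 2, 4, 6`; hence `χ̄₁ = ωχ̄₂⁻¹ ≠ χ̄₂` on `I_v` (potentially multiplicative places: `χ̄₂² =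
  1`).  X. Zhang 2024, Rem. 6.1.2 [arXiv:2412.06812, p. 33]: "In the ordinary case, the result is known by [SW01],
  [Kisin09], [HuTan15]".  So at a totally split `p` the three pure/mixed signatures are door 3 (g30, PRINT), door 4b
  (PRINT) and door 5 (GAP): `doors_cover_totallySplit`.
* DOOR 5 — MIX `MixedSignatureDoor` (AUTHOR-NAMED GAP, not in print): `p ∈ {3,5,7}` TOTALLY SPLIT in `K₀`,
  `ρ̄_{E,p}` absolutely irreducible, MIXED signature above `p` ⇒ modular.  Pan 2022, Remark 8.0.25 [Pan2022 =
  arXiv:1901.07166, after Thm. 8.0.24]: "If we are in the `mixed' situation, i.e. ρ|_{G_{F_v}} is reducible for some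
  v|p and irreducible for some other place v, it should be possible to work with some `mixture of completed cohomology
  and Hida family' … We leave the details to the interested readers."  X. Zhang 2024, Thm. 6.1.1 [XZhang2024 =
  arXiv:2412.06812, p. 33] (g30's door 3, no `F(ζ_p)` hypothesis) still requires `ρ|_{G_{F_v}}` absolutely irreducible
  for ALL `v ∣ p`.  On a totally split `p` (`K₀ᵥ = ℚ_p`, `e = 1`) distinguishedness at the nearly-ordinary places is
  AUTOMATIC (`ω|_{I_v}` has order `p − 1 ∉ {1, 2, 3}` = the possible orders of `χ̄₂²|_{I_v}`; at `p = 3`: `μ₃ ⊄ ℚ₃`),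
  so the door carries no distinguishedness clause.  Residual automorphy of `ρ̄` as in g30's door-3 chain (3).  THE GAP
  IS AT `p ∈ {3, 7}`: at a totally split `5`, `√5 ∉ K₀`, the quadratic subfield `K₀(√5)` of `K₀(ζ₅)` is totally real and
  the dihedral case in ANY signature is Thorne 2016, Thm. 7.5 (tree fact `Thorne2016_theorem7_5_ellipticCurve`); the
  birth skeleton of MIX cuts accordingly (`stub_mixFive` PRINT-by-name modulo rendering, `stub_mixThreeSeven` GAP).
* DECLARED RESIDUAL — RES33 `SignatureResidual` = CORE off doors 4a, 4b and 5 (`OffSignatureDoors`).  What is in it: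
  the residually-REDUCIBLE loci (a Borel framing at `p` kills every door at `p`, `offSignatureDoors_of_borel`; the
  `X₀(105)` cell `CellB3B5B7` of g31 is provably untouched, `cellB3B5B7_unchanged`) — `ResiduallyReducibleBarrier` on
  NON-ABELIAN `K₀` (Pan 2022 Thm. 7.1.1 / Skinner–Wiles 1999 / X. Zhang 2024–25 all need `F/ℚ` abelian; Thorne 2026
  [arXiv:2608.07186, Thm. B / Thm. 4.1] reaches only POTENTIAL modularity without an `F`-rational modular
  approximation); and, at each `p ∈ {3,5,7}` where `E[p]` IS absolutely irreducible (dihedral), `p` is NOT totally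
  split in `K₀` (`not_modPAbsIrreducible_of_offDoors_split`) and, for `p = 3`, some place above `3` is supersingular
  or has `μ₃ ⊂ K₀ᵥ`.

## Kernel (0 sorry; axioms `propext`, `Classical.choice`, `Quot.sound`)

* `core_of_pieces : NOD₃ → NOS → MIX → RES33 → CORE` (excluded middle on doors 4a, 4b, 5 — pointwise
  `modular_of_not_offSignatureDoors`), `signatureResidual_of_core` (RES33 is a sub-family of CORE: WEAKER, one more
  hypothesis), `core_iff_signatureResidual` (EXACT modulo the three junctions).
* `noSupersingularAbove_of_potMultAbove`, `noLocus_of_swLocus` / `splitNOLocus_of_swLocus` (door 2 ⊆ doors 4a/4b prime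
  by prime), `signature_trichotomy`, `doors_cover_totallySplit` (on a `p`-totally-split field an absolutely irreducible
  non-generic `E[p]` is on door 3, 4b or 5 — nothing of it is left in RES33: `not_modPAbsIrreducible_of_offDoors_split`).
* Joint with g31: `not_isAbsolutelyIrreducible_of_borel` (an upper-triangular framing has the invariant line `⟨e₀⟩`),
  `not_modPAbsIrreducible_of_borelAt`, `offSignatureDoors_of_borel`, `cellB3B5B7_unchanged`, the three shrunken level
  cells `Cell33S3B5B7`, `Cell33B3B5E7`, `Cell33S3B5E7`, `disjointFieldCell_of_cells33` / `cells33_of_disjointFieldCell`,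
  `refined_of_pieces` / `refinedSignature_of_refined` (CORE′ version), `core_of_box13_pieces`.
* Joint with g32 (`ModuliFieldDescentSplit`, tree: the moduli-degree dial `JPrimitive`, which COMMUTES with the signature
  dial): PRIM33 `PrimitiveSignatureResidual` = PRIM off the signature doors, `primitive_of_pieces : NOD₃ → NOS → MIX →
  PRIM33 → PRIM`, `primitive_iff_primitiveSignature`, `core_of_primitive_pieces` (g32's `core_of_pieces` with PRIM
  replaced by NOD₃ ∧ NOS ∧ MIX ∧ PRIM33).
* Compositions BY NAME through the tree's `OddPrimeDoorSplit.residual_of_core` / `largeJResidual_of_core` /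
  `restE_of_core` / `closes_target`: `residual_of_pieces`, `largeJResidual_of_pieces`, `restE_of_pieces`,
  `closes_target`, `closes_byName` (g30's binder list with `CoreResidual` replaced by NOD₃ ∧ NOS ∧ MIX ∧ RES33), and the
  necessity maps `signatureResidual_of_residual` / `_of_largeJResidual` / `_of_restE`.

Tags for the critic: NOD₃, NOS = PRINT junctions (binders; credit nothing; ⊇ SWD at `3`, resp. at totally split `p`);
MIX = GAP / IDEA-NEEDED at `p ∈ {3,7}` (author-sketched programme, instrumentable: ordinary parts of completed cohomology
at the reducible places; its `p = 5` part is PRINT, Thorne 2016 Thm. 7.5); RES33 = WEAKER, NECESSARY, RESIDUAL (declared).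
No `instance`, no `notation`, no `sorry`.
-/

set_option linter.dupNamespace false
set_option linter.unusedVariables false

open scoped NumberField IntermediateField MatrixGroups
open NumberField IsDedekindDomain Field Literature.NumberTheory.Automorphic
open Literature.NumberTheory.GaloisRepresentations
open Summit.Langlands.Langlands.Theorems.DepthIsolationSplit (UnanchoredBox UnanchoredHighDegreeModularE
  IntegralModelTransferPointwise SatakeAvatarTwo satakeAvatarTwo_of_host)
open Summit.Langlands.Langlands.Theorems.JDegreeFilterSplit (jInv jDeg InResidualRange LargeJResidual
  RatBaseChangeModularity SmallFieldBaseChange largeJResidual_of_restE)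
open Summit.Langlands.Langlands.Theorems.DyadicDoorSplit (AllenLocus AllenDyadicCorollary DyadicDegenerateResidual
  residual_of_largeJResidual)
open Summit.Langlands.Langlands.Theorems.OddPrimeDoorSplit (Generic357 ModPAbsIrreducible PotMultAbove NoLocalMuAbove
  SWLocus OnSWDoor TotallySplitAt PotSupersingularAbove PZLocus OnPZDoor OffDoors CoreResidual
  SkinnerWilesDihedralDoor PanZhangSupersingularDoor residual_of_core core_of_residual largeJResidual_of_core
  restE_of_core core_of_largeJResidual core_of_restE)
open Summit.Langlands.Langlands.Theorems.RealCyclotomicDoorSplit (BorelAt SplitCartanThree E7Seven BoxShape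
  RefinedCore OnDisjointCell CellB3B5B7 CellS3B5B7 CellB3B5E7 CellS3B5E7 DisjointFieldCell EntangledFieldCell
  core_of_refined refined_of_core borelOrSplitCartanThree_iff borelOrE7Seven_iff disjointFieldCell_iff_levelCells)
open Summit.Langlands.Langlands.Theorems.ModuliFieldDescentSplit (JPrimitive PrimitiveCoreResidual PrimitiveRefinedCore
  AnchoredBPrimitiveModularity TotallyRealBaseChange prim_of_core)

namespace Summit.Langlands.Langlands.Theorems.ReductionSignatureSplit

/-! ## §5 Joint with g31 (`RealCyclotomicDoorSplit`): Borel framings are off all signature doors -/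

/-- An UPPER-TRIANGULAR framing (`(ρ σ)₁₀ = 0` for all `σ`, g31's `BorelAt` clause; column-vector convention
`FramedRep.toRepresentation_apply_apply`) is NOT absolutely irreducible: the line spanned by `e₀` is a proper non-zero
subrepresentation. [folklore] -/
theorem not_isAbsolutelyIrreducible_of_borel {K₀ : Type} [Field K₀] [NumberField K₀] {p : ℕ} [Fact p.Prime]
    (ρ : FramedGaloisRep K₀ (ZMod p) 2)
    (h : ∀ σ : absoluteGaloisGroup K₀, ((ρ σ : GL (Fin 2) (ZMod p)) : Matrix (Fin 2) (Fin 2) (ZMod p)) 1 0 = 0) :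
    ¬ FramedRep.IsAbsolutelyIrreducible ρ := by
  intro habs
  have hirr : ρ.toRepresentation.IsIrreducible := habs.isIrreducible
  have hinv : ∀ (σ : absoluteGaloisGroup K₀) (v : Fin 2 → ZMod p),
      v ∈ Submodule.span (ZMod p) {(Pi.single 0 1 : Fin 2 → ZMod p)} →
        ρ.toRepresentation σ v ∈ Submodule.span (ZMod p) {(Pi.single 0 1 : Fin 2 → ZMod p)} := by
    intro σ v hv
    rw [Submodule.mem_span_singleton] at hv ⊢
    obtain ⟨c, rfl⟩ := hv
    refine ⟨c * ((ρ σ : GL (Fin 2) (ZMod p)) : Matrix (Fin 2) (Fin 2) (ZMod p)) 0 0, ?_⟩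
    rw [map_smul, FramedRep.toRepresentation_apply_apply]
    ext i
    fin_cases i
    · simp [mul_comm]
    · simp [h σ]
  let W : Subrepresentation ρ.toRepresentation :=
    ⟨Submodule.span (ZMod p) {(Pi.single 0 1 : Fin 2 → ZMod p)}, fun σ v hv => hinv σ v hv⟩
  haveI := hirr
  rcases eq_bot_or_eq_top W with hb | ht
  · have hmem : (Pi.single 0 1 : Fin 2 → ZMod p) ∈ W.toSubmodule := Submodule.mem_span_singleton_self _
    rw [hb] at hmem
    change (Pi.single 0 1 : Fin 2 → ZMod p) ∈ (⊥ : Submodule (ZMod p) (Fin 2 → ZMod p)) at hmem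
    rw [Submodule.mem_bot] at hmem
    have h0 := congrFun hmem 0
    simp at h0
  · have hmem : (Pi.single 1 1 : Fin 2 → ZMod p) ∈ W.toSubmodule := by
      rw [ht]
      change (Pi.single 1 1 : Fin 2 → ZMod p) ∈ (⊤ : Submodule (ZMod p) (Fin 2 → ZMod p))
      exact Submodule.mem_top
    change (Pi.single 1 1 : Fin 2 → ZMod p) ∈
      Submodule.span (ZMod p) {(Pi.single 0 1 : Fin 2 → ZMod p)} at hmem
    rw [Submodule.mem_span_singleton] at hmem
    obtain ⟨c, hc⟩ := hmem
    have h1 := congrFun hc 1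
    simp at h1

/-- A Borel framing at `p` (g31's `BorelAt`) kills g30's `ModPAbsIrreducible` at `p` (all framings of `E[p]` enter
`ModPAbsIrreducible` universally; `ModPGaloisRep` is an `abbrev` of `FramedGaloisRep`). -/
theorem not_modPAbsIrreducible_of_borelAt {K₀ : Type} [Field K₀] [NumberField K₀] {E : WeierstrassCurve (𝓞 K₀)}
    {p : ℕ} [Fact p.Prime] (h : BorelAt K₀ E p) : ¬ ModPAbsIrreducible K₀ E p := by
  obtain ⟨ρ, hρ, hB⟩ := h
  exact fun habs => not_isAbsolutelyIrreducible_of_borel ρ hB (habs ρ hρ)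

/-- Borel at `3` ⇒ off door 4a. -/
theorem not_onNODoor_of_borelAt {K₀ : Type} [Field K₀] [NumberField K₀] {E : WeierstrassCurve (𝓞 K₀)}
    (h : BorelAt K₀ E 3) : ¬ OnNODoor K₀ E :=
  fun hn => not_modPAbsIrreducible_of_borelAt h hn.1

/-- Borel at `p` ⇒ off the split nearly-ordinary locus at `p`. -/
theorem not_splitNOLocus_of_borelAt {K₀ : Type} [Field K₀] [NumberField K₀] {E : WeierstrassCurve (𝓞 K₀)}
    {p : ℕ} [Fact p.Prime] (h : BorelAt K₀ E p) : ¬ SplitNOLocus K₀ E p :=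
  fun hs => not_modPAbsIrreducible_of_borelAt h hs.2.1

/-- Borel at `3`, `5` and `7` ⇒ off door 4b. -/
theorem not_onSplitNODoor_of_borel {K₀ : Type} [Field K₀] [NumberField K₀] {E : WeierstrassCurve (𝓞 K₀)}
    (h3 : BorelAt K₀ E 3) (h5 : BorelAt K₀ E 5) (h7 : BorelAt K₀ E 7) : ¬ OnSplitNODoor K₀ E := by
  rintro ⟨p, hp, hp357, hsl⟩
  rcases hp357 with rfl | rfl | rfl
  · exact not_splitNOLocus_of_borelAt (p := 3) h3 hsl
  · haveI : Fact (Nat.Prime 5) := ⟨hp⟩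
    exact not_splitNOLocus_of_borelAt h5 hsl
  · haveI : Fact (Nat.Prime 7) := ⟨hp⟩
    exact not_splitNOLocus_of_borelAt h7 hsl

/-- Borel at `p` ⇒ off the mixed locus at `p`. -/
theorem not_mixLocus_of_borelAt {K₀ : Type} [Field K₀] [NumberField K₀] {E : WeierstrassCurve (𝓞 K₀)}
    {p : ℕ} [Fact p.Prime] (h : BorelAt K₀ E p) : ¬ MixLocus K₀ E p :=
  fun hm => not_modPAbsIrreducible_of_borelAt h hm.2.1

/-- The `X₀(105)` locus (Borel at `3`, `5` and `7`) is OFF all signature doors: this node does NOT bite on g31's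
`CellB3B5B7` (honest no-bite certificate, cf. `cellB3B5B7_unchanged`). -/
theorem offSignatureDoors_of_borel {K₀ : Type} [Field K₀] [NumberField K₀] {E : WeierstrassCurve (𝓞 K₀)}
    (h3 : BorelAt K₀ E 3) (h5 : BorelAt K₀ E 5) (h7 : BorelAt K₀ E 7) : OffSignatureDoors K₀ E := by
  refine ⟨not_onNODoor_of_borelAt h3, not_onSplitNODoor_of_borel h3 h5 h7, ?_⟩
  rintro ⟨p, hp, hp357, hmix⟩
  rcases hp357 with rfl | rfl | rfl
  · exact not_mixLocus_of_borelAt (p := 3) h3 hmix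
  · haveI : Fact (Nat.Prime 5) := ⟨hp⟩
    exact not_mixLocus_of_borelAt h5 hmix
  · haveI : Fact (Nat.Prime 7) := ⟨hp⟩
    exact not_mixLocus_of_borelAt h7 hmix

/-- g31's `X₀(105)` cell is LITERALLY unchanged by the new dial. -/
theorem cellB3B5B7_unchanged :
    CellB3B5B7 ↔
      ∀ (K₀ : Type) [Field K₀] [NumberField K₀] (E : WeierstrassCurve (𝓞 K₀)), OnDisjointCell K₀ E →
        BorelAt K₀ E 3 → BorelAt K₀ E 5 → BorelAt K₀ E 7 → OffSignatureDoors K₀ E → IsModularEllipticCurve K₀ E :=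
  ⟨fun h K₀ _ _ E hc h3 h5 h7 _ => h K₀ E hc h3 h5 h7,
    fun h K₀ _ _ E hc h3 h5 h7 => h K₀ E hc h3 h5 h7 (offSignatureDoors_of_borel h3 h5 h7)⟩

/-- RES33′ — CORE′ (g31's `RefinedCore`) off the three signature doors. -/
def RefinedSignatureResidual : Prop :=
  ∀ (K₀ : Type) [Field K₀] [NumberField K₀], UnanchoredBox K₀ →
    ∀ E : WeierstrassCurve (𝓞 K₀), E.Δ ≠ 0 → InResidualRange K₀ E → ¬ AllenLocus K₀ E → OffDoors K₀ E →
      BoxShape K₀ E → OffSignatureDoors K₀ E → IsModularEllipticCurve K₀ E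

/-- CORE′ ⟸ NOD₃ ∧ NOS ∧ MIX ∧ RES33′. -/
theorem refined_of_pieces (hNOD : NearlyOrdinaryDihedralDoorThree) (hNOS : SplitOrdinaryDihedralDoor)
    (hMIX : MixedSignatureDoor) (hR : RefinedSignatureResidual) : RefinedCore := by
  intro K₀ _ _ hb E hΔ hr hA hoff hS
  haveI : IsTotallyReal K₀ := hb.1
  by_cases h33 : OffSignatureDoors K₀ E
  · exact hR K₀ hb E hΔ hr hA hoff hS h33
  · exact modular_of_not_offSignatureDoors hNOD hNOS hMIX E hΔ h33

/-- CORE′ ⟹ RES33′. -/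
theorem refinedSignature_of_refined (h : RefinedCore) : RefinedSignatureResidual :=
  fun K₀ _ _ hb E hΔ hr hA hoff hS _ => h K₀ hb E hΔ hr hA hoff hS

/-- EXACTNESS (CORE′ version): modulo the three junctions, CORE′ ⟺ RES33′. -/
theorem refined_iff_refinedSignature (hNOD : NearlyOrdinaryDihedralDoorThree) (hNOS : SplitOrdinaryDihedralDoor)
    (hMIX : MixedSignatureDoor) : RefinedCore ↔ RefinedSignatureResidual :=
  ⟨refinedSignature_of_refined, refined_of_pieces hNOD hNOS hMIX⟩

/-- KERNEL joint with g31: BOX13 → NOD₃ → NOS → MIX → RES33′ → CORE. -/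
theorem core_of_box13_pieces (hB : Box2022_theorem1_3) (hNOD : NearlyOrdinaryDihedralDoorThree)
    (hNOS : SplitOrdinaryDihedralDoor) (hMIX : MixedSignatureDoor) (hR : RefinedSignatureResidual) : CoreResidual :=
  core_of_refined hB (refined_of_pieces hNOD hNOS hMIX hR)

/-- LEVEL CELL `(s3, b5, b7)` of g31 off the signature doors (doors 4a, 4b, 5 at `3` bite: `C_s⁺(3)` is absolutely
irreducible and dihedral). -/
def Cell33S3B5B7 : Prop :=
  ∀ (K₀ : Type) [Field K₀] [NumberField K₀] (E : WeierstrassCurve (𝓞 K₀)), OnDisjointCell K₀ E →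
    SplitCartanThree K₀ E → BorelAt K₀ E 5 → BorelAt K₀ E 7 → OffSignatureDoors K₀ E → IsModularEllipticCurve K₀ E

/-- LEVEL CELL `(b3, b5, e7)` of g31 off the signature doors (doors 4b, 5 at `7` bite: `G(e7)` is absolutely
irreducible and dihedral). -/
def Cell33B3B5E7 : Prop :=
  ∀ (K₀ : Type) [Field K₀] [NumberField K₀] (E : WeierstrassCurve (𝓞 K₀)), OnDisjointCell K₀ E →
    BorelAt K₀ E 3 → BorelAt K₀ E 5 → E7Seven K₀ E → OffSignatureDoors K₀ E → IsModularEllipticCurve K₀ E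

/-- LEVEL CELL `(s3, b5, e7)` of g31 off the signature doors (all doors at `3` and doors 4b, 5 at `7` bite). -/
def Cell33S3B5E7 : Prop :=
  ∀ (K₀ : Type) [Field K₀] [NumberField K₀] (E : WeierstrassCurve (𝓞 K₀)), OnDisjointCell K₀ E →
    SplitCartanThree K₀ E → BorelAt K₀ E 5 → E7Seven K₀ E → OffSignatureDoors K₀ E → IsModularEllipticCurve K₀ E

/-- g31's CELL D ⟹ the three shrunken level cells (necessity). -/
theorem cells33_of_disjointFieldCell (hD : DisjointFieldCell) : Cell33S3B5B7 ∧ Cell33B3B5E7 ∧ Cell33S3B5E7 := by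
  obtain ⟨_, hSB, hBE, hSE⟩ := disjointFieldCell_iff_levelCells.1 hD
  exact ⟨fun K₀ _ _ E h h3 h5 h7 _ => hSB K₀ E h h3 h5 h7, fun K₀ _ _ E h h3 h5 h7 _ => hBE K₀ E h h3 h5 h7,
    fun K₀ _ _ E h h3 h5 h7 _ => hSE K₀ E h h3 h5 h7⟩

/-- KERNEL at cell level: NOD₃ → NOS → MIX → (b3b5b7 cell of g31, unchanged) → the three shrunken cells → CELL D. -/
theorem disjointFieldCell_of_cells33 (hNOD : NearlyOrdinaryDihedralDoorThree) (hNOS : SplitOrdinaryDihedralDoor)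
    (hMIX : MixedSignatureDoor) (hBB : CellB3B5B7) (hSB : Cell33S3B5B7) (hBE : Cell33B3B5E7) (hSE : Cell33S3B5E7) :
    DisjointFieldCell := by
  refine disjointFieldCell_iff_levelCells.2 ⟨hBB, ?_, ?_, ?_⟩
  · intro K₀ _ _ E h h3 h5 h7
    haveI : IsTotallyReal K₀ := h.1.1
    by_cases h33 : OffSignatureDoors K₀ E
    · exact hSB K₀ E h h3 h5 h7 h33
    · exact modular_of_not_offSignatureDoors hNOD hNOS hMIX E h.2.2.2.1 h33
  · intro K₀ _ _ E h h3 h5 h7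
    haveI : IsTotallyReal K₀ := h.1.1
    by_cases h33 : OffSignatureDoors K₀ E
    · exact hBE K₀ E h h3 h5 h7 h33
    · exact modular_of_not_offSignatureDoors hNOD hNOS hMIX E h.2.2.2.1 h33
  · intro K₀ _ _ E h h3 h5 h7
    haveI : IsTotallyReal K₀ := h.1.1
    by_cases h33 : OffSignatureDoors K₀ E
    · exact hSE K₀ E h h3 h5 h7 h33
    · exact modular_of_not_offSignatureDoors hNOD hNOS hMIX E h.2.2.2.1 h33

/-- On the `(b3, b5, e7)` cell no door bites at `3` or `5` (Borel) and doors 4b, 5 can bite only at `7`. -/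
theorem offSignatureDoors_of_borel_three_five {K₀ : Type} [Field K₀] [NumberField K₀] {E : WeierstrassCurve (𝓞 K₀)}
    (h3 : BorelAt K₀ E 3) (h5 : BorelAt K₀ E 5) (h7 : ¬ @MixLocus K₀ _ _ E 7 ⟨by norm_num⟩)
    (h7' : ¬ @SplitNOLocus K₀ _ _ E 7 ⟨by norm_num⟩) : OffSignatureDoors K₀ E := by
  refine ⟨not_onNODoor_of_borelAt h3, ?_, ?_⟩
  · rintro ⟨p, hp, hp357, hsl⟩
    rcases hp357 with rfl | rfl | rfl
    · exact not_splitNOLocus_of_borelAt (p := 3) h3 hsl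
    · haveI : Fact (Nat.Prime 5) := ⟨hp⟩
      exact not_splitNOLocus_of_borelAt h5 hsl
    · exact h7' hsl
  · rintro ⟨p, hp, hp357, hmix⟩
    rcases hp357 with rfl | rfl | rfl
    · exact not_mixLocus_of_borelAt (p := 3) h3 hmix
    · haveI : Fact (Nat.Prime 5) := ⟨hp⟩
      exact not_mixLocus_of_borelAt h5 hmix
    · exact h7 hmix

/-! ## §6 Compositions BY NAME up to RES, LJR, REST_E and REST (stmt-Langlands-26998) -/

/-- Up to RES (g28's `DyadicDegenerateResidual`) through the tree's `OddPrimeDoorSplit.residual_of_core`. -/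
theorem residual_of_pieces (h34 : FLS2015_theorems3_4) (hSW : SkinnerWilesDihedralDoor)
    (hPZ : PanZhangSupersingularDoor) (hNOD : NearlyOrdinaryDihedralDoorThree) (hNOS : SplitOrdinaryDihedralDoor)
    (hMIX : MixedSignatureDoor) (hR : SignatureResidual) : DyadicDegenerateResidual :=
  residual_of_core h34 hSW hPZ (core_of_pieces hNOD hNOS hMIX hR)

/-- Up to LJR through the tree's `OddPrimeDoorSplit.largeJResidual_of_core`. -/
theorem largeJResidual_of_pieces (hADC : AllenDyadicCorollary) (h34 : FLS2015_theorems3_4)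
    (hSW : SkinnerWilesDihedralDoor) (hPZ : PanZhangSupersingularDoor) (hNOD : NearlyOrdinaryDihedralDoorThree)
    (hNOS : SplitOrdinaryDihedralDoor) (hMIX : MixedSignatureDoor) (hR : SignatureResidual) : LargeJResidual :=
  largeJResidual_of_core hADC h34 hSW hPZ (core_of_pieces hNOD hNOS hMIX hR)

/-- Up to REST_E through the tree's `OddPrimeDoorSplit.restE_of_core`. -/
theorem restE_of_pieces (hDBC : RatBaseChangeModularity) (hNSBC : SmallFieldBaseChange)
    (hFLS : FLS2015_theorem1) (hDNS : DNS2020_theorem4) (hBox : Box2022_theorem1_1)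
    (hADC : AllenDyadicCorollary) (h34 : FLS2015_theorems3_4) (hSW : SkinnerWilesDihedralDoor)
    (hPZ : PanZhangSupersingularDoor) (hNOD : NearlyOrdinaryDihedralDoorThree) (hNOS : SplitOrdinaryDihedralDoor)
    (hMIX : MixedSignatureDoor) (hR : SignatureResidual) : UnanchoredHighDegreeModularE :=
  restE_of_core hDBC hNSBC hFLS hDNS hBox hADC h34 hSW hPZ (core_of_pieces hNOD hNOS hMIX hR)

/-- KERNEL COMPOSITION concluding REST = `TowerDoorSplit.UnanchoredHighDegreeWitnessAutomorphy`
(stmt-Langlands-26998) BY NAME, through the tree's `OddPrimeDoorSplit.closes_target` (g30's binder list with CORE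
replaced by NOD₃ ∧ NOS ∧ MIX ∧ RES33). -/
theorem closes_target (hDBC : RatBaseChangeModularity) (hNSBC : SmallFieldBaseChange)
    (hFLS : FLS2015_theorem1) (hDNS : DNS2020_theorem4) (hBox : Box2022_theorem1_1)
    (hADC : AllenDyadicCorollary) (h34 : FLS2015_theorems3_4) (hSW : SkinnerWilesDihedralDoor)
    (hPZ : PanZhangSupersingularDoor) (hNOD : NearlyOrdinaryDihedralDoorThree) (hNOS : SplitOrdinaryDihedralDoor)
    (hMIX : MixedSignatureDoor) (hR : SignatureResidual) (hIMT : IntegralModelTransferPointwise)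
    (hTr : Summit.Langlands.Langlands.Theses.EllipticDegreeLadder.EllipticTransportAnyBase)
    (hW : SatakeAvatarTwo)
    (h1 : Summit.Langlands.Langlands.Theses.EllipticDegreeLadder.RankOneAutomorphy) :
    Summit.Langlands.Langlands.Theses.TowerDoorSplit.UnanchoredHighDegreeWitnessAutomorphy :=
  Summit.Langlands.Langlands.Theorems.OddPrimeDoorSplit.closes_target hDBC hNSBC hFLS hDNS hBox hADC h34 hSW hPZ
    (core_of_pieces hNOD hNOS hMIX hR) hIMT hTr hW h1

/-- `closes_target` with W⁺ the host item `SatakeAvatarExistence` (stmt-Langlands-17415) BY NAME. -/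
theorem closes_byName (hDBC : RatBaseChangeModularity) (hNSBC : SmallFieldBaseChange)
    (hFLS : FLS2015_theorem1) (hDNS : DNS2020_theorem4) (hBox : Box2022_theorem1_1)
    (hADC : AllenDyadicCorollary) (h34 : FLS2015_theorems3_4) (hSW : SkinnerWilesDihedralDoor)
    (hPZ : PanZhangSupersingularDoor) (hNOD : NearlyOrdinaryDihedralDoorThree) (hNOS : SplitOrdinaryDihedralDoor)
    (hMIX : MixedSignatureDoor) (hR : SignatureResidual) (hIMT : IntegralModelTransferPointwise)
    (hTr : Summit.Langlands.Langlands.Theses.EllipticDegreeLadder.EllipticTransportAnyBase)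
    (hW : Summit.Langlands.Langlands.Theses.EllipticDegreeLadder.SatakeAvatarExistence)
    (h1 : Summit.Langlands.Langlands.Theses.EllipticDegreeLadder.RankOneAutomorphy) :
    Summit.Langlands.Langlands.Theses.TowerDoorSplit.UnanchoredHighDegreeWitnessAutomorphy :=
  closes_target hDBC hNSBC hFLS hDNS hBox hADC h34 hSW hPZ hNOD hNOS hMIX hR hIMT hTr (satakeAvatarTwo_of_host hW) h1

/-! ### Necessity from the lineage targets (the trivial direction) -/

/-- RES ⇒ RES33. -/
theorem signatureResidual_of_residual (h : DyadicDegenerateResidual) : SignatureResidual :=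
  signatureResidual_of_core (core_of_residual h)

/-- LJR ⇒ RES33. -/
theorem signatureResidual_of_largeJResidual (h : LargeJResidual) : SignatureResidual :=
  signatureResidual_of_core (core_of_largeJResidual h)

/-- REST_E ⇒ RES33. -/
theorem signatureResidual_of_restE (h : UnanchoredHighDegreeModularE) : SignatureResidual :=
  signatureResidual_of_core (core_of_restE h)

end Summit.Langlands.Langlands.Theorems.ReductionSignatureSplit
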